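import Literature.NumberTheory.Rogawski1990.ArchStableOrbitalFamilyHJunction      -- ★ p849802 (LH3-p02) R1: `classOrbitalIntegral_mul_measure_box_eq_chartOrbH`, `chartTorusH_eq_centralizer_of_mem_regS`; brings (T-MEAS), B1, (CENT-H), (CUR)
import Literature.NumberTheory.Rogawski1990.ArchBouazizStableFamily              -- ★ p849717 (LH3-p01): `stOrbFamH`, `stOrbFamH_of_mem_regS`; brings ★ `stableSum`∕`flipSet` (ArchCartanStableSum)
import Literature.NumberTheory.Automorphic.ArchEndoscopicChartExhaustion            -- ★ p849783 (LH3-p03) (EXH-H): `exists_conj_endoTorus_of_isArchGRegular`, `isArchGRegular_endoTorus_iff_mem_regG`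
import HarnessLib

/-!
# The stable side of the archimedean transfer identity READ ON THE CHARTS (R4 = (READ-H) of the LH3 direct road)
# (Rogawski 1990 §4.1 (4.1.1), §4.3 (4.3.1), §14.3; Shelstad 1979 §4; Deitmar–Echterhoff 2014 Thm. 1.5.3)

Topic `NumberTheory/Rogawski1990`; namespace `Literature.NumberTheory.Rogawski1990`.  THEOREMS ONLY (no `def`, no instance, no notation, no axiom, no named fact, no
`sorry`).  Cell `pub/hodgecm-mathlib`, crux H413 (`stmt-HodgeConjecture-24833`), F0∕P3c line LH3 (closer stub `stub_N9`, DIRECT ROAD, organ `stub_N9read`); brick R4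
(READ-H) of LH3-plan (g2)'s O-READ partition 2026-09-02T06:30:06Z (R1 junctions LH3-p02 ★ p849781∕p849802, R2 Δ″-side chart sum LH3-p03, R3 box coherence LH1-p02,
R4 this file); seat LH2-p04 (g3).  Count-neutral.

WHAT `stub_N9read` NEEDS AND WHAT IS HERE.  The identity `IsArchDeltaTransfer L H′ T m_H m′ f_H a′` (§14.3: for every `G`-regular `γ_H ∈ H_∞`,
`Φ^st(γ_H, f_H; m_H) = ∑ᶠ_{c′} Δ(γ_H, out c′) · Φ(c′, a′; m′)`) is to be READ from the chart identity `stOrbFamH = transfFam (orbFamG)` on `RegS S`.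
* §1 CLASS-FUNCTION REDUCTIONS: both sides of (4.3.1) are class functions of `γ_H` — `stableOrbitalIntegralRel_conj` (stable conjugacy absorbs `H_∞`-conjugacy:
  ★ `stableOrbitalIntegralRel_congr`), `finsum_delta_mul_classOrbitalIntegral_conj` (for any factor invariant under `γ_H ↦ x γ_H x⁻¹`, e.g. ★
  `archExplicitDelta_conj_left`) — so by ★ (EXH-H) the identity need only be checked AT THE CHART POINTS `γ_H = endoTorus S c`, `c ∈ RegG S`:
  **`isArchDeltaTransfer_of_forall_chart`**.
* §2 THE STABLE SIDE AT A CHART POINT, as a chart functional: **`stableOrbitalIntegralRel_endoTorus_mul_eq_stableSum`** — for a frame in print's convention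
  ((W_H)+(C_H)+(C), the binders of ★ R1) and `c ∈ RegG S`,
  `Φ^st(endoTorus S c, f_H; m_H) · M = stableSum S (chartOrbH ν_H S f_H) c  (= (archRH S c)⁻¹ · stOrbFamH ν_H f_H S c)`,
  where `M` is the common frame mass of the chart box `B_S` at the flip points.  INPUTS, stated as hypotheses where not yet ★ (flagged to LH3-plan per the deal):
  (hidx) the `H_∞`-classes inside the stable class of `endoTorus S c` are exactly the `2^{#(Wᶜ∖S)}` FLIP classes `⟦endoTorus S (flipSet T c)⟧`, `T ⊆ univ ∖ S`
  (⊇ = flips are stably conjugate — `P·swap·P⁻¹` at the compact places; ⊆ = exhaustion inside the stable class; distinctness = no element of `U(1,1)` swaps a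
  positive and a negative eigenline); (hbox) the frame mass of `B_S` is the same at every flip point ((C_H)+(C): R3's box coherence on the `H` side).  With
  these, each flip term is ★ R1's junction `classOrbitalIntegral_mul_measure_box_eq_chartOrbH` at the `G`-regular chart point `flipSet T c`
  (`flipSet_mem_regG`, ★ `isArchGRegular_endoTorus_iff_mem_regG`, ★ `chartTorusH_eq_centralizer_of_mem_regS`), and the `finsum` is the `Finset` sum
  (`finsum_mem_image`).  Corollary **`stableOrbitalIntegralRel_endoTorus_mul_eq_stOrbFamH`** (★ `stOrbFamH_of_mem_regS`).
HONEST LABEL: HC_CM is proved only modulo the 7 printed citations (2 remaining: hLiu418 = `stmt-HodgeConjecture-24832`, h413 = `stmt-HodgeConjecture-24833`) until rung 0 closes;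
count-neutral (the organ `stub_N9read` is assembled later from R1–R4).

## References
* [Rogawski1990] J. D. Rogawski, *Automorphic Representations of Unitary Groups in Three Variables*, Ann. of Math. Stud. 123 (1990), §4.1 (4.1.1) p. 39 (stable orbital
  integral as a sum over the classes in the stable class), §4.3 (4.3.1) p. 43, §14.3 pp. 233–234, §3.6 p. 31.
* [Shelstad1979] D. Shelstad, *Characters and inner forms of a quasi-split group over ℝ*, Compositio Math. 39 (1979), §4 pp. 20–23.
* [DeitmarEchterhoff2014] A. Deitmar, S. Echterhoff, *Principles of Harmonic Analysis*, 2nd ed. (2014), Thm. 1.5.3.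
-/

set_option autoImplicit false

noncomputable section

open MeasureTheory MeasureTheory.Measure NumberField NumberField.InfinitePlace Matrix Complex Topology
open Literature.MeasureTheory.Group
open scoped MatrixGroups Matrix Classical NNReal ENNReal

namespace Literature.NumberTheory.Rogawski1990

open Literature.NumberTheory.Automorphic Literature.NumberTheory.Automorphic.UnitaryGroup Literature.NumberTheory.Automorphic.ArchCartan

/-! ## §1 Class-function reductions: the identity need only be read at the chart points -/

section ClassFunction

variable (L : Type) [Field L] [NumberField L] [IsCMField L]

/-- Stable conjugacy in `H_∞` absorbs `H_∞`-conjugacy on the left: `x γ x⁻¹ ∼_st y ↔ γ ∼_st y`. [cite: Rogawski1990, §3.1 p. 19; §4.1 p. 39] -/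
theorem isArchStablyConjH_conj_left_iff (γ x y : (↥(arch (↥(maximalRealSubfield L)) L (IsCMField.complexConj L) 2 (Matrix.of fun i j : Fin 2 => if i.val + j.val + 1 = 2 then (1 : L) else 0)) × ↥(arch (↥(maximalRealSubfield L)) L (IsCMField.complexConj L) 1 (Matrix.of fun i j : Fin 1 => if i.val + j.val + 1 = 1 then (1 : L) else 0)))) :
    IsArchStablyConjH L (x * γ * x⁻¹) y ↔ IsArchStablyConjH L γ y := by
  have hst : IsArchStablyConjH L γ (x * γ * x⁻¹) := isStablyConjH_of_isConj (isConj_iff.2 ⟨x, rfl⟩)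
  exact ⟨fun h => hst.trans h, fun h => hst.symm.trans h⟩

variable [∀ a : (↥(arch (↥(maximalRealSubfield L)) L (IsCMField.complexConj L) 2 (Matrix.of fun i j : Fin 2 => if i.val + j.val + 1 = 2 then (1 : L) else 0)) × ↥(arch (↥(maximalRealSubfield L)) L (IsCMField.complexConj L) 1 (Matrix.of fun i j : Fin 1 => if i.val + j.val + 1 = 1 then (1 : L) else 0))), MeasurableSpace ((↥(arch (↥(maximalRealSubfield L)) L (IsCMField.complexConj L) 2 (Matrix.of fun i j : Fin 2 => if i.val + j.val + 1 = 2 then (1 : L) else 0)) × ↥(arch (↥(maximalRealSubfield L)) L (IsCMField.complexConj L) 1 (Matrix.of fun i j : Fin 1 => if i.val + j.val + 1 = 1 then (1 : L) else 0))) ⧸ Subgroup.centralizer ({a} : Set (↥(arch (↥(maximalRealSubfield L)) L (IsCMField.complexConj L) 2 (Matrix.of fun i j : Fin 2 => if i.val + j.val + 1 = 2 then (1 : L) else 0)) × ↥(arch (↥(maximalRealSubfield L)) L (IsCMField.complexConj L) 1 (Matrix.of fun i j : Fin 1 => if i.val + j.val + 1 = 1 then (1 : L) else 0)))))]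

/-- **The stable orbital integral is a CLASS FUNCTION of `γ_H`**: `Φ^st(x γ_H x⁻¹, f_H; m_H) = Φ^st(γ_H, f_H; m_H)` (the stable class of `x γ_H x⁻¹` is that of `γ_H`).
[cite: Rogawski1990, §4.1 (4.1.1) p. 39] -/
theorem stableOrbitalIntegralRel_conj (mH : OrbitalMeasureFamily (↥(arch (↥(maximalRealSubfield L)) L (IsCMField.complexConj L) 2 (Matrix.of fun i j : Fin 2 => if i.val + j.val + 1 = 2 then (1 : L) else 0)) × ↥(arch (↥(maximalRealSubfield L)) L (IsCMField.complexConj L) 1 (Matrix.of fun i j : Fin 1 => if i.val + j.val + 1 = 1 then (1 : L) else 0)))) (fH : (↥(arch (↥(maximalRealSubfield L)) L (IsCMField.complexConj L) 2 (Matrix.of fun i j : Fin 2 => if i.val + j.val + 1 = 2 then (1 : L) else 0)) × ↥(arch (↥(maximalRealSubfield L)) L (IsCMField.complexConj L) 1 (Matrix.of fun i j : Fin 1 => if i.val + j.val + 1 = 1 then (1 : L) else 0))) → ℂ) (γ x : (↥(arch (↥(maximalRealSubfield L)) L (IsCMField.complexConj L) 2 (Matrix.of fun i j : Fin 2 =>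 if i.val + j.val + 1 = 2 then (1 : L) else 0)) × ↥(arch (↥(maximalRealSubfield L)) L (IsCMField.complexConj L) 1 (Matrix.of fun i j : Fin 1 => if i.val + j.val + 1 = 1 then (1 : L) else 0)))) :
    stableOrbitalIntegralRel (IsArchStablyConjH L) mH fH (x * γ * x⁻¹) = stableOrbitalIntegralRel (IsArchStablyConjH L) mH fH γ :=
  stableOrbitalIntegralRel_congr (fun y => isArchStablyConjH_conj_left_iff L γ x y) mH fH

variable {H' : Matrix (Fin 3) (Fin 3) L} [∀ γ : ↥(arch (↥(maximalRealSubfield L)) L (IsCMField.complexConj L) 3 H'), MeasurableSpace (↥(arch (↥(maximalRealSubfield L)) L (IsCMField.complexConj L) 3 H') ⧸ Subgroup.centralizer ({γ} : Set ↥(arch (↥(maximalRealSubfield L)) L (IsCMField.complexConj L) 3 H')))]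

omit [∀ a : (↥(arch (↥(maximalRealSubfield L)) L (IsCMField.complexConj L) 2 (Matrix.of fun i j : Fin 2 => if i.val + j.val + 1 = 2 then (1 : L) else 0)) × ↥(arch (↥(maximalRealSubfield L)) L (IsCMField.complexConj L) 1 (Matrix.of fun i j : Fin 1 => if i.val + j.val + 1 = 1 then (1 : L) else 0))), MeasurableSpace ((↥(arch (↥(maximalRealSubfield L)) L (IsCMField.complexConj L) 2 (Matrix.of fun i j : Fin 2 => if i.val + j.val + 1 = 2 then (1 : L) else 0)) × ↥(arch (↥(maximalRealSubfield L)) L (IsCMField.complexConj L) 1 (Matrix.of fun i j : Fin 1 => if i.val + j.val + 1 = 1 then (1 : L) else 0))) ⧸ Subgroup.centralizer ({a} : Set (↥(arch (↥(maximalRealSubfield L)) L (IsCMField.complexConj L) 2 (Matrix.of fun i j : Fin 2 => if i.val + j.val + 1 = 2 then (1 : L) else 0)) × ↥(arch (↥(maximalRealSubfield L)) L (IsCMField.complexConj L) 1 (Matrix.of fun i j : Fin 1 => if i.val + j.val + 1 = 1 then (1 : L) else 0)))))] in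
/-- **The Δ-side is a class function of `γ_H`** for every factor invariant under `γ_H ↦ x γ_H x⁻¹` (★ `archExplicitDelta_conj_left` for `Δ″_∞`).
[cite: Rogawski1990, §4.3 (4.3.1) p. 43; §4.9 p. 55] -/
theorem finsum_delta_mul_classOrbitalIntegral_conj (T : ArchTransferFactor L H') (hT : ∀ (a : (↥(arch (↥(maximalRealSubfield L)) L (IsCMField.complexConj L) 2 (Matrix.of fun i j : Fin 2 => if i.val + j.val + 1 = 2 then (1 : L) else 0)) × ↥(arch (↥(maximalRealSubfield L)) L (IsCMField.complexConj L) 1 (Matrix.of fun i j : Fin 1 => if i.val + j.val + 1 = 1 then (1 : L) else 0)))) (b : ↥(arch (↥(maximalRealSubfield L)) L (IsCMField.complexConj L) 3 H')) (x : (↥(arch (↥(maximalRealSubfield L)) L (IsCMField.complexConj L) 2 (Matrix.of fun i j : Fin 2 => if i.val + j.val + 1 = 2 then (1 : L) else 0)) × ↥(arch (↥(maximalRealSubfield L)) L (IsCMField.complexConj L) 1 (Matrix.of fun i j : Fin 1 => if i.val + j.val + 1 = 1 then (1 : L) else 0)))), T.Δ (x * a * x⁻¹) b = T.Δ a b)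
    (mG : OrbitalMeasureFamily ↥(arch (↥(maximalRealSubfield L)) L (IsCMField.complexConj L) 3 H')) (a : ↥(arch (↥(maximalRealSubfield L)) L (IsCMField.complexConj L) 3 H') → ℂ) (γ x : (↥(arch (↥(maximalRealSubfield L)) L (IsCMField.complexConj L) 2 (Matrix.of fun i j : Fin 2 => if i.val + j.val + 1 = 2 then (1 : L) else 0)) × ↥(arch (↥(maximalRealSubfield L)) L (IsCMField.complexConj L) 1 (Matrix.of fun i j : Fin 1 => if i.val + j.val + 1 = 1 then (1 : L) else 0)))) :
    ∑ᶠ c : ConjClasses ↥(arch (↥(maximalRealSubfield L)) L (IsCMField.complexConj L) 3 H'), T.Δ (x * γ * x⁻¹) (Quotient.out c) * classOrbitalIntegral mG a c =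
      ∑ᶠ c : ConjClasses ↥(arch (↥(maximalRealSubfield L)) L (IsCMField.complexConj L) 3 H'), T.Δ γ (Quotient.out c) * classOrbitalIntegral mG a c := by
  simp_rw [hT]

/-- **READ REDUCES TO THE CHART POINTS**: if the transfer identity (4.3.1) holds at every `G`-regular chart point `endoTorus S c` (`c ∈ RegG S`), it holds at every
`G`-regular `γ_H ∈ H_∞` (★ (EXH-H): `γ_H = h · endoTorus S c · h⁻¹`; both sides are class functions of `γ_H`). [cite: Rogawski1990, §14.3 pp. 233–234; §4.3 (4.3.1) p. 43] -/
theorem isArchDeltaTransfer_of_forall_chart (T : ArchTransferFactor L H') (hT : ∀ (a : (↥(arch (↥(maximalRealSubfield L)) L (IsCMField.complexConj L) 2 (Matrix.of fun i j : Fin 2 => if i.val + j.val + 1 = 2 then (1 : L) else 0)) × ↥(arch (↥(maximalRealSubfield L)) L (IsCMField.complexConj L) 1 (Matrix.of fun i j : Fin 1 => if i.val + j.val + 1 = 1 then (1 : L) else 0)))) (b : ↥(arch (↥(maximalRealSubfield L)) L (IsCMField.complexConj L) 3 H')) (x : (↥(arch (↥(maximalRealSubfield L)) L (IsCMField.complexConj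 L) 2 (Matrix.of fun i j : Fin 2 => if i.val + j.val + 1 = 2 then (1 : L) else 0)) × ↥(arch (↥(maximalRealSubfield L)) L (IsCMField.complexConj L) 1 (Matrix.of fun i j : Fin 1 => if i.val + j.val + 1 = 1 then (1 : L) else 0)))), T.Δ (x * a * x⁻¹) b = T.Δ a b)
    (mH : OrbitalMeasureFamily (↥(arch (↥(maximalRealSubfield L)) L (IsCMField.complexConj L) 2 (Matrix.of fun i j : Fin 2 => if i.val + j.val + 1 = 2 then (1 : L) else 0)) × ↥(arch (↥(maximalRealSubfield L)) L (IsCMField.complexConj L) 1 (Matrix.of fun i j : Fin 1 => if i.val + j.val + 1 = 1 then (1 : L) else 0)))) (mG : OrbitalMeasureFamily ↥(arch (↥(maximalRealSubfield L)) L (IsCMField.complexConj L) 3 H')) (fH : (↥(arch (↥(maximalRealSubfield L)) L (IsCMField.complexConj L) 2 (Matrix.of fun i j : Fin 2 => if i.val + j.val + 1 = 2 then (1 : L) else 0)) × ↥(arch (↥(maximalRealSubfield L)) L (IsCMField.complexConj L) 1 (Matrix.of fun i j : Fin 1 => if i.val + j.val + 1 = 1 then (1 : L) else 0))) → ℂ)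 (a : ↥(arch (↥(maximalRealSubfield L)) L (IsCMField.complexConj L) 3 H') → ℂ)
    (h : ∀ (S : Finset {w : InfinitePlace L // IsComplex w}) (c : {w : InfinitePlace L // IsComplex w} → Fin 3 → ℝ), c ∈ ArchCartan.RegG S →
      stableOrbitalIntegralRel (IsArchStablyConjH L) mH fH (endoTorus L S c) =
        ∑ᶠ c' : ConjClasses ↥(arch (↥(maximalRealSubfield L)) L (IsCMField.complexConj L) 3 H'), T.Δ (endoTorus L S c) (Quotient.out c') * classOrbitalIntegral mG a c') :
    IsArchDeltaTransfer L H' T mH mG fH a := by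
  intro γH hreg
  obtain ⟨S, c, x, hc, rfl⟩ := exists_conj_endoTorus_of_isArchGRegular L γH hreg
  rw [stableOrbitalIntegralRel_conj L mH fH (endoTorus L S c) x, finsum_delta_mul_classOrbitalIntegral_conj L T hT mG a (endoTorus L S c) x]
  exact h S c hc

end ClassFunction

/-! ## §2 The stable side at a chart point as a chart functional -/

section StableSide

/-- **Flips preserve `G`-regularity of the coordinates** (`T ⊆ univ ∖ S` permutes the two compact angle slots at its places). [cite: Rogawski1990, §4.3 p. 42] -/
theorem flipSet_mem_regG {W : Type*} [DecidableEq W] (S : Finset W) {T : Finset W} (hT : ∀ w ∈ T, w ∉ S) {c : W → Fin 3 → ℝ} (hc : c ∈ ArchCartan.RegG S) :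
    flipSet T c ∈ ArchCartan.RegG S := by
  rw [ArchCartan.mem_regG_iff] at hc ⊢
  refine ⟨fun w hw => ?_, fun w hw => ?_⟩
  · by_cases hwT : w ∈ T
    · rw [flipSet_apply_of_mem hwT]
      intro i j hij
      have hinj := hc.1 w hw
      fin_cases i <;> fin_cases j
      · rfl
      · exact absurd (hinj (by simpa using hij)) (by decide)
      · exact absurd (hinj (by simpa using hij)) (by decide)
      · exact absurd (hinj (by simpa using hij)) (by decide)
      · rfl
      · exact absurd (hinj (by simpa using hij)) (by decide)
      · exact absurd (hinj (by simpa using hij)) (by decide)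
      · exact absurd (hinj (by simpa using hij)) (by decide)
      · rfl
    · rw [flipSet_apply_of_not_mem hwT]
      exact hc.1 w hw
  · have hwT : w ∉ T := fun h => hT w h hw
    rw [flipSet_apply_of_not_mem hwT]
    exact hc.2 w hw

variable (L : Type) [Field L] [NumberField L] [IsCMField L]
  [MeasurableSpace ↥(arch (↥(maximalRealSubfield L)) L (IsCMField.complexConj L) 3 (Matrix.of fun i j : Fin 3 => if i.val + j.val + 1 = 3 then (1 : L) else 0))] [BorelSpace ↥(arch (↥(maximalRealSubfield L)) L (IsCMField.complexConj L) 3 (Matrix.of fun i j : Fin 3 => if i.val + j.val + 1 = 3 then (1 : L) else 0))]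
  [MeasurableSpace (↥(arch (↥(maximalRealSubfield L)) L (IsCMField.complexConj L) 2 (Matrix.of fun i j : Fin 2 => if i.val + j.val + 1 = 2 then (1 : L) else 0)) × ↥(arch (↥(maximalRealSubfield L)) L (IsCMField.complexConj L) 1 (Matrix.of fun i j : Fin 1 => if i.val + j.val + 1 = 1 then (1 : L) else 0)))] [BorelSpace (↥(arch (↥(maximalRealSubfield L)) L (IsCMField.complexConj L) 2 (Matrix.of fun i j : Fin 2 => if i.val + j.val + 1 = 2 then (1 : L) else 0)) × ↥(arch (↥(maximalRealSubfield L)) L (IsCMField.complexConj L) 1 (Matrix.of fun i j : Fin 1 => if i.val + j.val + 1 = 1 then (1 : L) else 0)))]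
  (t : ∀ γ : ↥(arch (↥(maximalRealSubfield L)) L (IsCMField.complexConj L) 3 (Matrix.of fun i j : Fin 3 => if i.val + j.val + 1 = 3 then (1 : L) else 0)), Measure (Subgroup.centralizer ({γ} : Set ↥(arch (↥(maximalRealSubfield L)) L (IsCMField.complexConj L) 3 (Matrix.of fun i j : Fin 3 => if i.val + j.val + 1 = 3 then (1 : L) else 0)))))
  (tH : ∀ γH : (↥(arch (↥(maximalRealSubfield L)) L (IsCMField.complexConj L) 2 (Matrix.of fun i j : Fin 2 => if i.val + j.val + 1 = 2 then (1 : L) else 0)) × ↥(arch (↥(maximalRealSubfield L)) L (IsCMField.complexConj L) 1 (Matrix.of fun i j : Fin 1 => if i.val + j.val + 1 = 1 then (1 : L) else 0))), Measure (Subgroup.centralizer ({γH} : Set (↥(arch (↥(maximalRealSubfield L)) L (IsCMField.complexConj L) 2 (Matrix.of fun i j : Fin 2 => if i.val + j.val + 1 = 2 then (1 : L) else 0)) × ↥(arch (↥(maximalRealSubfield L)) L (IsCMField.complexConj L) 1 (Matrix.of fun i j : Fin 1 => if i.val + j.val + 1 = 1 then (1 : L) else 0))))))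
  (hd₃ : ((Matrix.of fun i j : Fin 3 => if i.val + j.val + 1 = 3 then (1 : L) else 0) : Matrix (Fin 3) (Fin 3) L).det ≠ 0)
  (hC : ∀ (γ₁ γ₂ : ↥(arch (↥(maximalRealSubfield L)) L (IsCMField.complexConj L) 3 (Matrix.of fun i j : Fin 3 => if i.val + j.val + 1 = 3 then (1 : L) else 0))) (h₁ : IsRegularElt (γ₁.val : GL (Fin 3) (mixedEmbedding.mixedSpace L)))
      (hc : Corresponds (UnitaryGroup.conjMixed (↥(maximalRealSubfield L)) L (IsCMField.complexConj L))
        (UnitaryGroup.archFormOf L 3 (Matrix.of fun i j : Fin 3 => if i.val + j.val + 1 = 3 then (1 : L) else 0))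
        (UnitaryGroup.archFormOf L 3 (Matrix.of fun i j : Fin 3 => if i.val + j.val + 1 = 3 then (1 : L) else 0)) γ₁ γ₂),
      Measure.map ⇑(UnitaryGroup.archStableCentralizerEquiv L hd₃ hd₃ hc h₁) (t γ₁) = t γ₂)
  (hCH : ∀ γH : (↥(arch (↥(maximalRealSubfield L)) L (IsCMField.complexConj L) 2 (Matrix.of fun i j : Fin 2 => if i.val + j.val + 1 = 2 then (1 : L) else 0)) × ↥(arch (↥(maximalRealSubfield L)) L (IsCMField.complexConj L) 1 (Matrix.of fun i j : Fin 1 => if i.val + j.val + 1 = 1 then (1 : L) else 0))), IsArchGRegular L γH → Measure.map ⇑(endoEmbArchCentralizer L γH) (tH γH) = t (endoEmbArch L γH))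
  [qHH : ∀ a : (↥(arch (↥(maximalRealSubfield L)) L (IsCMField.complexConj L) 2 (Matrix.of fun i j : Fin 2 => if i.val + j.val + 1 = 2 then (1 : L) else 0)) × ↥(arch (↥(maximalRealSubfield L)) L (IsCMField.complexConj L) 1 (Matrix.of fun i j : Fin 1 => if i.val + j.val + 1 = 1 then (1 : L) else 0))), MeasurableSpace ((↥(arch (↥(maximalRealSubfield L)) L (IsCMField.complexConj L) 2 (Matrix.of fun i j : Fin 2 => if i.val + j.val + 1 = 2 then (1 : L) else 0)) × ↥(arch (↥(maximalRealSubfield L)) L (IsCMField.complexConj L) 1 (Matrix.of fun i j : Fin 1 => if i.val + j.val + 1 = 1 then (1 : L) else 0))) ⧸ Subgroup.centralizer ({a} : Set (↥(arch (↥(maximalRealSubfield L)) L (IsCMField.complexConj L) 2 (Matrix.of fun i j : Fin 2 => if i.val + j.val + 1 = 2 then (1 : L) else 0)) × ↥(arch (↥(maximalRealSubfield L)) L (IsCMField.complexConj L) 1 (Matrix.of fun i j : Fin 1 => if i.val + j.val + 1 = 1 then (1 : L) else 0)))))]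
  [qbHH : ∀ a : (↥(arch (↥(maximalRealSubfield L)) L (IsCMField.complexConj L) 2 (Matrix.of fun i j : Fin 2 => if i.val + j.val + 1 = 2 then (1 : L) else 0)) × ↥(arch (↥(maximalRealSubfield L)) L (IsCMField.complexConj L) 1 (Matrix.of fun i j : Fin 1 => if i.val + j.val + 1 = 1 then (1 : L) else 0))), BorelSpace ((↥(arch (↥(maximalRealSubfield L)) L (IsCMField.complexConj L) 2 (Matrix.of fun i j : Fin 2 => if i.val + j.val + 1 = 2 then (1 : L) else 0)) × ↥(arch (↥(maximalRealSubfield L)) L (IsCMField.complexConj L) 1 (Matrix.of fun i j : Fin 1 => if i.val + j.val + 1 = 1 then (1 : L) else 0))) ⧸ Subgroup.centralizer ({a} : Set (↥(arch (↥(maximalRealSubfield L)) L (IsCMField.complexConj L) 2 (Matrix.of fun i j : Fin 2 => if i.val + j.val + 1 = 2 then (1 : L) else 0)) × ↥(arch (↥(maximalRealSubfield L)) L (IsCMField.complexConj L) 1 (Matrix.of fun i j : Fin 1 => if i.val + j.val + 1 = 1 then (1 : L) else 0)))))]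
  (νH : Measure (↥(arch (↥(maximalRealSubfield L)) L (IsCMField.complexConj L) 2 (Matrix.of fun i j : Fin 2 => if i.val + j.val + 1 = 2 then (1 : L) else 0)) × ↥(arch (↥(maximalRealSubfield L)) L (IsCMField.complexConj L) 1 (Matrix.of fun i j : Fin 1 => if i.val + j.val + 1 = 1 then (1 : L) else 0)))) [νH.IsHaarMeasure] [νH.IsMulRightInvariant]
  (mH : OrbitalMeasureFamily (↥(arch (↥(maximalRealSubfield L)) L (IsCMField.complexConj L) 2 (Matrix.of fun i j : Fin 2 => if i.val + j.val + 1 = 2 then (1 : L) else 0)) × ↥(arch (↥(maximalRealSubfield L)) L (IsCMField.complexConj L) 1 (Matrix.of fun i j : Fin 1 => if i.val + j.val + 1 = 1 then (1 : L) else 0))))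
  (hWH : mH.IsQuotientOf (IsArchGRegular L) νH tH)

include hC hCH hWH in
/-- **THE STABLE ORBITAL INTEGRAL AT A CHART POINT IS THE CHART STABLE SUM** (up to the common frame mass `M` of the chart box): for a frame in print's measure
convention ((W_H)+(C_H)+(C)) and `c ∈ RegG S`,
`Φ^st(endoTorus S c, f_H; m_H) · M = stableSum S (chartOrbH ν_H S f_H) c = ∑_{T ⊆ univ∖S} chartOrbH ν_H S f_H (flipSet T c)`.
HYPOTHESES (flagged per the deal, to be discharged by sibling files): `hidx` — the `H_∞`-classes in the stable class of `endoTorus S c` are exactly the flip classes;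
`hinj` — the flip classes are pairwise distinct; `hbox` — the frame mass of the box `B_S` is the same number `M` at every flip point (R3-type coherence from (C_H)+(C)).
Each term is ★ R1's junction `classOrbitalIntegral_mul_measure_box_eq_chartOrbH` at the `G`-regular point `flipSet T c`.
[cite: Rogawski1990, §4.1 (4.1.1) p. 39; §4.3 (4.3.1) p. 43; §14.3 pp. 233–234] [cite: Shelstad1979, §4 pp. 20–22] [cite: DeitmarEchterhoff2014, Thm. 1.5.3] -/
theorem stableOrbitalIntegralRel_endoTorus_mul_eq_stableSum (S : Finset {w : InfinitePlace L // IsComplex w})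
    {c : {w : InfinitePlace L // IsComplex w} → Fin 3 → ℝ} (hc : c ∈ ArchCartan.RegG S)
    (fH : (↥(arch (↥(maximalRealSubfield L)) L (IsCMField.complexConj L) 2 (Matrix.of fun i j : Fin 2 => if i.val + j.val + 1 = 2 then (1 : L) else 0)) × ↥(arch (↥(maximalRealSubfield L)) L (IsCMField.complexConj L) 1 (Matrix.of fun i j : Fin 1 => if i.val + j.val + 1 = 1 then (1 : L) else 0))) → ℂ)
    (hidx : {c' : ConjClasses ((↥(arch (↥(maximalRealSubfield L)) L (IsCMField.complexConj L) 2 (Matrix.of fun i j : Fin 2 => if i.val + j.val + 1 = 2 then (1 : L) else 0)) × ↥(arch (↥(maximalRealSubfield L)) L (IsCMField.complexConj L) 1 (Matrix.of fun i j : Fin 1 => if i.val + j.val + 1 = 1 then (1 : L) else 0)))) |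
        IsArchStablyConjH L (endoTorus L S c) (Quotient.out c')} =
      (fun T : Finset {w : InfinitePlace L // IsComplex w} => ConjClasses.mk (endoTorus L S (flipSet T c))) '' ↑((Finset.univ \ S).powerset))
    (hinj : Set.InjOn (fun T : Finset {w : InfinitePlace L // IsComplex w} => ConjClasses.mk (endoTorus L S (flipSet T c))) ↑((Finset.univ \ S).powerset))
    (M : ℝ)
    (hbox : ∀ T ∈ (Finset.univ \ S).powerset, ∀ hP : chartTorusH L S = Subgroup.centralizer ({endoTorus L S (flipSet T c)} : Set ((↥(arch (↥(maximalRealSubfield L)) L (IsCMField.complexConj L) 2 (Matrix.of fun i j : Fin 2 => if i.val + j.val + 1 = 2 then (1 : L) else 0)) × ↥(arch (↥(maximalRealSubfield L)) L (IsCMField.complexConj L) 1 (Matrix.of fun i j : Fin 1 => if i.val + j.val + 1 = 1 then (1 : L) else 0))))),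
      ((tH (endoTorus L S (flipSet T c))).map ⇑(MulEquiv.subgroupCongr hP).symm (chartBoxImg L S)).toReal = M) :
    stableOrbitalIntegralRel (IsArchStablyConjH L) mH fH (endoTorus L S c) * (M : ℂ) = stableSum S (chartOrbH L νH S fH) c := by
  rw [stableOrbitalIntegralRel_def, hidx, finsum_mem_image hinj, finsum_mem_coe_finset, stableSum_def, Finset.sum_mul]
  refine Finset.sum_congr rfl fun T hT => ?_
  have hTS : ∀ w ∈ T, w ∉ S := not_mem_of_mem_powerset_sdiff hT
  have hcT : flipSet T c ∈ ArchCartan.RegG S := flipSet_mem_regG S hTS hc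
  have hreg : IsArchGRegular L (endoTorus L S (flipSet T c)) := (isArchGRegular_endoTorus_iff_mem_regG L S _).2 hcT
  have hP := chartTorusH_eq_centralizer_of_mem_regS L S (ArchCartan.regG_subset_regS S hcT)
  rw [← classOrbitalIntegral_mul_measure_box_eq_chartOrbH L t tH hd₃ hC hCH νH mH hWH S hP hreg fH, hbox T hT hP]

include hC hCH hWH in
/-- **The same, in the D2-pack's family currency**: `Φ^st(endoTorus S c, f_H; m_H) · M · archRH S c = stOrbFamH ν_H f_H S c` on `RegG S` (★ `stOrbFamH_of_mem_regS`).
[cite: Rogawski1990, §4.1 (4.1.1) p. 39; §14.3 pp. 233–234] [cite: Shelstad1979, §4 p. 22] -/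
theorem stableOrbitalIntegralRel_endoTorus_mul_eq_stOrbFamH (S : Finset {w : InfinitePlace L // IsComplex w})
    {c : {w : InfinitePlace L // IsComplex w} → Fin 3 → ℝ} (hc : c ∈ ArchCartan.RegG S)
    (fH : (↥(arch (↥(maximalRealSubfield L)) L (IsCMField.complexConj L) 2 (Matrix.of fun i j : Fin 2 => if i.val + j.val + 1 = 2 then (1 : L) else 0)) × ↥(arch (↥(maximalRealSubfield L)) L (IsCMField.complexConj L) 1 (Matrix.of fun i j : Fin 1 => if i.val + j.val + 1 = 1 then (1 : L) else 0))) → ℂ)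
    (hidx : {c' : ConjClasses ((↥(arch (↥(maximalRealSubfield L)) L (IsCMField.complexConj L) 2 (Matrix.of fun i j : Fin 2 => if i.val + j.val + 1 = 2 then (1 : L) else 0)) × ↥(arch (↥(maximalRealSubfield L)) L (IsCMField.complexConj L) 1 (Matrix.of fun i j : Fin 1 => if i.val + j.val + 1 = 1 then (1 : L) else 0)))) |
        IsArchStablyConjH L (endoTorus L S c) (Quotient.out c')} =
      (fun T : Finset {w : InfinitePlace L // IsComplex w} => ConjClasses.mk (endoTorus L S (flipSet T c))) '' ↑((Finset.univ \ S).powerset))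
    (hinj : Set.InjOn (fun T : Finset {w : InfinitePlace L // IsComplex w} => ConjClasses.mk (endoTorus L S (flipSet T c))) ↑((Finset.univ \ S).powerset))
    (M : ℝ)
    (hbox : ∀ T ∈ (Finset.univ \ S).powerset, ∀ hP : chartTorusH L S = Subgroup.centralizer ({endoTorus L S (flipSet T c)} : Set ((↥(arch (↥(maximalRealSubfield L)) L (IsCMField.complexConj L) 2 (Matrix.of fun i j : Fin 2 => if i.val + j.val + 1 = 2 then (1 : L) else 0)) × ↥(arch (↥(maximalRealSubfield L)) L (IsCMField.complexConj L) 1 (Matrix.of fun i j : Fin 1 => if i.val + j.val + 1 = 1 then (1 : L) else 0))))),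
      ((tH (endoTorus L S (flipSet T c))).map ⇑(MulEquiv.subgroupCongr hP).symm (chartBoxImg L S)).toReal = M) :
    stableOrbitalIntegralRel (IsArchStablyConjH L) mH fH (endoTorus L S c) * (M : ℂ) * archRH S c = stOrbFamH L νH fH S c := by
  rw [stableOrbitalIntegralRel_endoTorus_mul_eq_stableSum L t tH hd₃ hC hCH νH mH hWH S hc fH hidx hinj M hbox,
    stOrbFamH_of_mem_regS L νH fH S (ArchCartan.regG_subset_regS S hc), stableSum_def, mul_comm]

end StableSide

end Literature.NumberTheory.Rogawski1990

end
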